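import Literature.Probability.RandomPlanarGeometry.RadialBesselMarkovKernel
import Literature.Probability.RandomPlanarGeometry.SLETraceApproximation
import Literature.Probability.Process.TwoSidedExtension
import Literature.Probability.Process.PathSpaceBorel
import HarnessLib

/-!
# The one-sided stationary SLE_κ(0) angle process (`κ ≤ 4`): path law, stationarity, martingale problem

Topic `Probability/RandomPlanarGeometry`; auxiliary definitions with bodies (`ArgGood`, `argPath`,
`flowPath`, `rawFlowPath`, `flowLaw`) and proved theorems (no named fact). Sequel of
`RadialBesselMarkovKernel`. For `κ ≤ 4` the SLE_κ radial Bessel flow `Y^θ_t(ω)`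
(`RadialLoewner.sleArg`; `dY = cot(Y/2) dt - √κ dB`, LSW (2002), (2.11); Lawler (2005), (1.16))
from `θ ∈ (0, 2π)` lives for ever in `(0, 2π)` for a.e. Brownian path. We package it as a
**random continuous path** and compute the **law of the process started from a probability measure
`μ` on `(0, 2π)`**:

* `argPath U hc (θ, ω) : C(ℝ≥0, ℝ)` — the maximal radial Bessel flow of a family of continuous
  driving paths as a continuous path (on the good set `ArgGood`: start in `(0, 2π)` and infinite
  lifetime; the constant path `π` otherwise), Borel measurable in `(θ, ω)`; `flowPath κ`
  (canonical Brownian driving path `√κ B`) and `rawFlowPath κ` (universal flow on the raw path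
  space) are its two instances, and `rawFlowPath κ (y, B(ω)) = flowPath κ (y, ω)`;
* `flowLaw κ μ = (μ ⊗ W) ∘ (flowPath κ)⁻¹`, a probability measure on `C([0, ∞), ℝ)` all of whose
  paths lie in `(0, 2π)`; its time-`t` marginal is `μ P_t` (`map_eval_flowLaw`);
* `map_shiftPath_flowLaw` — **stationarity**: if `μ P_h = μ` then `flowLaw κ μ` is invariant under
  the time shift `z ↦ z(h + ·)` (pathwise restart `sleArg_add_eq_pathArg` at the fixed time `h`,
  independence and Brownian law of the increments after `h`, `BrownianStrongMarkov`);
* `integral_mul_angleIncrement_flowLaw_eq_zero` — **the martingale problem, integrated against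
  past cylinder functionals**: `E[G · (f(Z_t) - f(Z_s) - ∫ₛᵗ L₀ f(Z_u) du)] = 0` for `f ∈ C²_c(0, 2π)`,
  `s ≤ t`, and bounded `G` depending measurably on finitely many coordinates at times `≤ s`
  (generator identity `integral_mul_angleIncrement_sleArg_eq_zero`, Fubini over `μ`).

With an invariant `μ` (`StationaryAngleInvariantMeasure`) this is the one-sided stationary
solution of the SLE_κ(0) angle equation; its two-sided extension (`Process.TwoSidedExtension`) is
the stationary angle law of Miller–Sheffield (2013), Prop. 2.1 (`StationaryAngleLawExistence`).

## References

* J. Miller, S. Sheffield, *Imaginary geometry IV*, PTRF 169 (2017), arXiv:1302.4738, §2.1.2,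
  Prop. 2.1. [MillerSheffield2013]
* J.-F. Le Gall, *Brownian Motion, Martingales, and Stochastic Calculus* (2016), Prop. 2.5,
  Thm 2.20 (Markov property). [Legall2016]
* I. Karatzas, S. Shreve, *Brownian Motion and Stochastic Calculus* (1988), Ch. 5 §4.B.
  [KaratzasShreve1988]
-/

noncomputable section

open MeasureTheory ProbabilityTheory Filter Topology Set
open scoped NNReal ENNReal

namespace Literature.Probability.RandomPlanarGeometry

/-! ### Borel structure on the one-sided path space

The Borel σ-algebra on `C([0, ∞), ℝ)` (compact-open topology) is the tree's scoped instance
`PathBorel.instMeasurableSpaceDrivingPath` (`SLETraceApproximation`), reused here via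
`open scoped PathBorel`; it is generated by the evaluations (`PathSpaceBorel`). -/

open scoped PathBorel

/-- A map into the one-sided path space is measurable as soon as all its evaluations are.
[folklore] -/
theorem measurable_of_eval_oneSided {Ω : Type*} [MeasurableSpace Ω] {Φ : Ω → C(ℝ≥0, ℝ)}
    (h : ∀ t, Measurable fun ω ↦ Φ ω t) : Measurable Φ :=
  Process.measurable_continuousMap_of_eval h

/-- The evaluations of the one-sided path space are measurable. [folklore] -/
theorem measurable_eval_oneSided (t : ℝ≥0) : Measurable fun z : C(ℝ≥0, ℝ) ↦ z t :=
  (continuous_eval_const t).measurable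

/-- The time shift of one-sided paths is measurable. [folklore] -/
theorem measurable_shiftPath (h : ℝ≥0) : Measurable (Process.shiftPath h) :=
  (Process.continuous_shiftPath h).measurable

/-- **The set of paths staying in `(0, 2π)` at all times is Borel.** [folklore] -/
theorem measurableSet_forall_mem_Ioo_oneSided :
    MeasurableSet {z : C(ℝ≥0, ℝ) | ∀ t, z t ∈ Ioo 0 (2 * Real.pi)} := by
  have h : {z : C(ℝ≥0, ℝ) | ∀ t, z t ∈ Ioo 0 (2 * Real.pi)} =
      ⋂ n : ℕ, {z : C(ℝ≥0, ℝ) | MapsTo z (Icc (0 : ℝ≥0) n) (Ioo 0 (2 * Real.pi))} := by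
    ext z
    simp only [mem_setOf_eq, mem_iInter]
    refine ⟨fun hz n t _ ↦ hz t, fun hz t ↦ ?_⟩
    obtain ⟨n, hn⟩ := exists_nat_ge (t : ℝ)
    exact hz n ⟨bot_le, by exact_mod_cast hn⟩
  rw [h]
  refine MeasurableSet.iInter fun n ↦ ?_
  have := Process.measurableSet_setOf_mapsTo (α := ℝ≥0) (β := ℝ) (isCompact_Icc (a := (0 : ℝ≥0)) (b := n))
    (isOpen_Ioo (a := (0 : ℝ)) (b := 2 * Real.pi))
  rwa [← Process.borel_continuousMap_eq_iSup_comap_eval] at this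

namespace RadialLoewner

open Literature.Probability.Process

/-! ### The radial Bessel flow as a random continuous path -/

section ArgPath

variable {Ω : Type*} {mΩ : MeasurableSpace Ω} {U : Ω → ℝ≥0 → ℝ} (hc : ∀ ω, Continuous (U ω))

/-- **With infinite lifetime the maximal flow is a continuous path.** [folklore] -/
theorem continuous_arg_of_lifetime_eq_top {θ : ℝ} {ω : Ω} (h : lifetime U hc θ ω = ⊤) :
    Continuous fun t ↦ arg U hc θ t ω := by
  refine continuous_iff_continuousAt.2 fun t ↦ ?_
  have ht : ((t + 1 : ℝ≥0) : WithTop ℝ≥0) < lifetime U hc θ ω := by rw [h]; exact WithTop.coe_lt_top _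
  obtain ⟨N, hN⟩ := eventually_lt_exitLevel hc ht
  exact ((continuousOn_arg hc (hN N le_rfl).le).continuousAt (Iic_mem_nhds (lt_add_one t)))

variable (U) in
/-- **The good set**: starts in `(0, 2π)` with infinite lifetime. [folklore] -/
def ArgGood : Set (ℝ × Ω) := {p | p.1 ∈ Ioo 0 (2 * Real.pi) ∧ lifetime U hc p.1 p.2 = ⊤}

/-- The good set is measurable (paths measurable at each time). [folklore] -/
theorem measurableSet_argGood (hmeas : ∀ s, Measurable fun ω ↦ U ω s) :
    MeasurableSet (ArgGood U hc) :=
  (measurableSet_Ioo.preimage measurable_fst).inter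
    ((measurable_lifetime_prod hc hmeas) (measurableSet_singleton ⊤))

variable (U) in
open Classical in
/-- **The maximal radial Bessel flow as a continuous path** (`argPath U hc (θ, ω) t = Y^θ_t(ω)`
on the good set; the constant path `π` off it — a junk value inside the state space).
[folklore] -/
def argPath (p : ℝ × Ω) : C(ℝ≥0, ℝ) :=
  if h : p ∈ ArgGood U hc then ⟨fun t ↦ arg U hc p.1 t p.2, continuous_arg_of_lifetime_eq_top hc h.2⟩
  else ⟨fun _ ↦ Real.pi, continuous_const⟩

open Classical in
/-- Value of the flow path. [folklore] -/
theorem argPath_apply (p : ℝ × Ω) (t : ℝ≥0) :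
    argPath U hc p t = if p ∈ ArgGood U hc then arg U hc p.1 t p.2 else Real.pi := by
  unfold argPath
  split_ifs <;> rfl

/-- On the good set the flow path is the flow. [folklore] -/
theorem argPath_apply_of_mem {p : ℝ × Ω} (h : p ∈ ArgGood U hc) (t : ℝ≥0) :
    argPath U hc p t = arg U hc p.1 t p.2 := by
  rw [argPath_apply, if_pos h]

/-- Off the good set the flow path is the constant `π`. [folklore] -/
theorem argPath_apply_of_not_mem {p : ℝ × Ω} (h : p ∉ ArgGood U hc) (t : ℝ≥0) :
    argPath U hc p t = Real.pi := by
  rw [argPath_apply, if_neg h]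

/-- **Every flow path lies in `(0, 2π)` at all times.** [folklore] -/
theorem argPath_mem_Ioo (p : ℝ × Ω) (t : ℝ≥0) : argPath U hc p t ∈ Ioo 0 (2 * Real.pi) := by
  by_cases h : p ∈ ArgGood U hc
  · rw [argPath_apply_of_mem hc h]
    exact arg_mem_Ioo hc h.1 (by rw [h.2]; exact WithTop.coe_lt_top t)
  · rw [argPath_apply_of_not_mem hc h]
    exact ⟨Real.pi_pos, by linarith [Real.pi_pos]⟩

/-- **The flow path is Borel measurable in `(θ, ω)`.** [folklore] -/
theorem measurable_argPath (hmeas : ∀ s, Measurable fun ω ↦ U ω s) : Measurable (argPath U hc) := by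
  classical
  refine measurable_of_eval_oneSided fun t ↦ ?_
  have h : (fun p : ℝ × Ω ↦ argPath U hc p t) =
      fun p ↦ if p ∈ ArgGood U hc then arg U hc p.1 t p.2 else Real.pi := by
    funext p; exact argPath_apply hc p t
  rw [h]
  exact Measurable.ite (measurableSet_argGood hc hmeas) (measurable_arg_prod hc hmeas t)
    measurable_const

/-- **The flow path depends on the driving path only through its increments.** [folklore] -/
theorem argPath_congr {Ω' : Type*} {U' : Ω' → ℝ≥0 → ℝ}
    (hc' : ∀ ω', Continuous (U' ω')) {ω : Ω} {ω' : Ω'}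
    (hpath : ∀ u, U' ω' u - U' ω' 0 = U ω u - U ω 0) (y : ℝ) :
    argPath U' hc' (y, ω') = argPath U hc (y, ω) := by
  have hT : lifetime U' hc' y ω' = lifetime U hc y ω := lifetime_congr hc hc' hpath y
  have hiff : (y, ω') ∈ ArgGood U' hc' ↔ (y, ω) ∈ ArgGood U hc := by
    simp only [ArgGood, mem_setOf_eq, hT]
  ext t
  by_cases h : (y, ω) ∈ ArgGood U hc
  · rw [argPath_apply_of_mem hc h, argPath_apply_of_mem hc' (hiff.2 h)]
    exact arg_congr hc hc' hpath y t
  · rw [argPath_apply_of_not_mem hc h, argPath_apply_of_not_mem hc' (mt hiff.1 h)]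

end ArgPath

/-! ### The two instances: canonical Brownian driving path, raw path space -/

section Instances

variable (κ : ℝ≥0)

/-- **The SLE_κ radial Bessel flow path** `flowPath κ (θ, ω) = (t ↦ Y^θ_t(ω))` on the canonical
space. [folklore] -/
abbrev flowPath (p : ℝ × (ℝ≥0 → ℝ)) : C(ℝ≥0, ℝ) :=
  argPath (sleDriving κ) (continuous_sleDriving' κ) p

/-- **The universal radial Bessel flow path** on the raw path space (driven by `pathDriving κ w`).
[folklore] -/
abbrev rawFlowPath (p : ℝ × (ℝ≥0 → ℝ)) : C(ℝ≥0, ℝ) :=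
  argPath (pathDriving κ) (continuous_pathDriving κ) p

/-- The canonical flow path is measurable. [folklore] -/
theorem measurable_flowPath : Measurable (flowPath κ) :=
  measurable_argPath _ (measurable_sleDriving_apply κ)

/-- The universal flow path is measurable. [folklore] -/
theorem measurable_rawFlowPath : Measurable (rawFlowPath κ) :=
  measurable_argPath _ (measurable_pathDriving κ)

/-- **On the Brownian path the universal flow path is the canonical one.** [folklore] -/
theorem rawFlowPath_brownian (y : ℝ) (ω : ℝ≥0 → ℝ) :
    rawFlowPath κ (y, fun u ↦ brownian u ω) = flowPath κ (y, ω) :=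
  argPath_congr (continuous_sleDriving' κ) (continuous_pathDriving κ) (pathDriving_brownian_sub κ ω) y

variable {κ}

/-- On the good set the canonical flow path is the SLE_κ process. [folklore] -/
theorem flowPath_apply_of_mem {θ : ℝ} {ω : ℝ≥0 → ℝ} (hθ : θ ∈ Ioo 0 (2 * Real.pi))
    (hT : sleLifetime κ θ ω = ⊤) (t : ℝ≥0) : flowPath κ (θ, ω) t = sleArg κ θ t ω :=
  argPath_apply_of_mem (continuous_sleDriving' κ) (p := (θ, ω)) ⟨hθ, hT⟩ t

/-- **The good set has full measure** under `μ ⊗ W` when `μ` is carried by `(0, 2π)` and `κ ≤ 4`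
(infinite lifetime, `ae_sleLifetime_eq_top`). [folklore] -/
theorem ae_mem_argGood (hκ : κ ≤ 4) {μ : Measure ℝ} [SFinite μ]
    (hμ : ∀ᵐ θ ∂μ, θ ∈ Ioo 0 (2 * Real.pi)) :
    ∀ᵐ p ∂(μ.prod preWienerMeasure),
      p ∈ ArgGood (sleDriving κ) (continuous_sleDriving' κ) := by
  haveI := isProbabilityMeasure_preWienerMeasure'
  rw [Measure.ae_prod_mem_iff_ae_ae_mem (measurableSet_argGood _ (measurable_sleDriving_apply κ))]
  filter_upwards [hμ] with θ hθ
  filter_upwards [ae_sleLifetime_eq_top hκ hθ] with ω hω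
  exact ⟨hθ, hω⟩

/-- **Pathwise restart of the flow path at a fixed time `h`**: on the good set,
`Y^θ_{h+·}(ω)` is the universal flow path started from `Y^θ_h(ω)` and driven by the increments
`Z^h = B_{h+·} - B_h`. [folklore] -/
theorem shiftPath_flowPath_eq {θ : ℝ} {ω : ℝ≥0 → ℝ} (hθ : θ ∈ Ioo 0 (2 * Real.pi))
    (hT : sleLifetime κ θ ω = ⊤) (h : ℝ≥0) :
    shiftPath h (flowPath κ (θ, ω)) =
      rawFlowPath κ (sleArg κ θ h ω, fun u ↦ brownianIncrAfter (fun _ ↦ (h : WithTop ℝ≥0)) u ω) := by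
  -- the restarted data lie in the good set of the universal flow
  have hh : ((h : ℝ≥0) : WithTop ℝ≥0) < sleLifetime κ θ ω := by rw [hT]; exact WithTop.coe_lt_top h
  have hy : sleArg κ θ h ω ∈ Ioo 0 (2 * Real.pi) := arg_mem_Ioo (continuous_sleDriving' κ) hθ hh
  have hT' : lifetime (pathDriving κ) (continuous_pathDriving κ) (sleArg κ θ h ω)
      (fun u ↦ brownianIncrAfter (fun _ ↦ (h : WithTop ℝ≥0)) u ω) = ⊤ := by
    rw [lifetime_congr (continuous_shiftFam (continuous_sleDriving' κ) h) (continuous_pathDriving κ)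
      (fun u ↦ pathDriving_brownianIncrAfter_sub (κ := κ) (ρ := fun _ ↦ (h : WithTop ℝ≥0)) rfl u)]
    have hadd := lifetime_eq_add (continuous_sleDriving' κ) θ ω hh
    have hT2 : lifetime (sleDriving κ) (continuous_sleDriving' κ) θ ω = ⊤ := hT
    rw [hT2] at hadd
    exact ((WithTop.add_eq_top.1 hadd.symm).resolve_left WithTop.coe_ne_top)
  ext u
  rw [shiftPath_apply, flowPath_apply_of_mem hθ hT,
    argPath_apply_of_mem (continuous_pathDriving κ) (p := (sleArg κ θ h ω, fun u ↦
      brownianIncrAfter (fun _ ↦ (h : WithTop ℝ≥0)) u ω)) ⟨hy, hT'⟩]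
  have hu : ((h + u : ℝ≥0) : WithTop ℝ≥0) < sleLifetime κ θ ω := by rw [hT]; exact WithTop.coe_lt_top _
  exact sleArg_add_eq_pathArg hu

end Instances

/-! ### The law of the flow started from `μ` -/

section Law

variable (κ : ℝ≥0)

/-- **The law of the SLE_κ radial Bessel process started from `μ`**, as a probability measure on
`C([0, ∞), ℝ)`: `flowLaw κ μ = (μ ⊗ W) ∘ (flowPath κ)⁻¹`. [folklore] -/
def flowLaw (μ : Measure ℝ) : Measure C(ℝ≥0, ℝ) := (μ.prod preWienerMeasure).map (flowPath κ)

/-- The flow law of a probability measure is a probability measure. [folklore] -/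
instance isProbabilityMeasure_flowLaw (μ : Measure ℝ) [IsProbabilityMeasure μ] :
    IsProbabilityMeasure (flowLaw κ μ) := by
  haveI := isProbabilityMeasure_preWienerMeasure'
  exact Measure.isProbabilityMeasure_map (measurable_flowPath κ).aemeasurable

variable {κ}

/-- The flow law on measurable sets. [folklore] -/
theorem flowLaw_apply {μ : Measure ℝ} [SFinite μ] {A : Set C(ℝ≥0, ℝ)} (hA : MeasurableSet A) :
    flowLaw κ μ A = ∫⁻ θ, preWienerMeasure {ω | flowPath κ (θ, ω) ∈ A} ∂μ := by
  haveI := isProbabilityMeasure_preWienerMeasure'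
  rw [flowLaw, Measure.map_apply (measurable_flowPath κ) hA,
    Measure.prod_apply ((measurable_flowPath κ) hA)]
  rfl

/-- **All paths of the flow law lie in `(0, 2π)`.** [folklore] -/
theorem ae_flowLaw_forall_mem_Ioo (μ : Measure ℝ) :
    ∀ᵐ z ∂(flowLaw κ μ), ∀ t, z t ∈ Ioo 0 (2 * Real.pi) := by
  rw [flowLaw]
  refine (ae_map_iff (measurable_flowPath κ).aemeasurable measurableSet_forall_mem_Ioo_oneSided).2 ?_
  exact ae_of_all _ fun p t ↦ argPath_mem_Ioo _ p t

/-- Integrals of bounded functionals against the flow law (Fubini). [folklore] -/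
theorem integral_flowLaw {μ : Measure ℝ} [IsProbabilityMeasure μ] {F : C(ℝ≥0, ℝ) → ℝ}
    (hF : Measurable F) {C : ℝ} (hFb : ∀ z, |F z| ≤ C) :
    ∫ z, F z ∂(flowLaw κ μ) = ∫ θ, ∫ ω, F (flowPath κ (θ, ω)) ∂preWienerMeasure ∂μ := by
  haveI := isProbabilityMeasure_preWienerMeasure'
  rw [flowLaw, integral_map (measurable_flowPath κ).aemeasurable hF.aestronglyMeasurable]
  have hint : Integrable (fun p : ℝ × (ℝ≥0 → ℝ) ↦ F (flowPath κ p)) (μ.prod preWienerMeasure) :=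
    (integrable_const C).mono' (hF.comp (measurable_flowPath κ)).aestronglyMeasurable
      (Eventually.of_forall fun p ↦ by rw [Real.norm_eq_abs]; exact hFb _)
  rw [integral_prod _ hint]

/-- A product measure pushed forward along a jointly measurable map is a mixture of the
section laws. [folklore] -/
theorem map_prod_eq_bind {α β γ : Type*} [MeasurableSpace α] [MeasurableSpace β] [MeasurableSpace γ]
    (μ : Measure α) (ν : Measure β) [SFinite ν] {f : α × β → γ} (hf : Measurable f) :
    (μ.prod ν).map f = μ.bind fun a ↦ ν.map fun b ↦ f (a, b) := by
  have hfa : ∀ a, Measurable fun b ↦ f (a, b) := fun a ↦ hf.comp measurable_prodMk_left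
  have hk : Measurable fun a ↦ ν.map fun b ↦ f (a, b) := by
    refine Measure.measurable_of_measurable_coe _ fun s hs ↦ ?_
    have h1 : (fun a ↦ (ν.map fun b ↦ f (a, b)) s) = fun a ↦ ν (Prod.mk a ⁻¹' (f ⁻¹' s)) := by
      funext a
      rw [Measure.map_apply (hfa a) hs]
      rfl
    rw [h1]
    exact measurable_measure_prodMk_left (hf hs)
  ext s hs
  rw [Measure.map_apply hf hs, Measure.prod_apply (hf hs), Measure.bind_apply hs hk.aemeasurable]
  refine lintegral_congr fun a ↦ ?_
  rw [Measure.map_apply (hfa a) hs]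
  rfl

/-- **The time-`t` marginal of the flow law is `μ P_t`** (`κ ≤ 4`, `μ` carried by `(0, 2π)`).
[folklore] -/
theorem map_eval_flowLaw (hκ : κ ≤ 4) {μ : Measure ℝ} [IsProbabilityMeasure μ]
    (hμ : ∀ᵐ θ ∂μ, θ ∈ Ioo 0 (2 * Real.pi)) (t : ℝ≥0) :
    (flowLaw κ μ).map (fun z ↦ z t) = μ.bind (sleKernel κ t) := by
  haveI := isProbabilityMeasure_preWienerMeasure'
  rw [flowLaw, Measure.map_map (measurable_eval_oneSided t) (measurable_flowPath κ)]
  have hae : ((fun z : C(ℝ≥0, ℝ) ↦ z t) ∘ flowPath κ) =ᵐ[μ.prod preWienerMeasure]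
      fun p ↦ sleArg κ p.1 t p.2 :=
    (ae_mem_argGood hκ hμ).mono fun p hp ↦ argPath_apply_of_mem _ hp t
  rw [Measure.map_congr hae, map_prod_eq_bind μ preWienerMeasure (measurable_sleArg_prod κ t)]
  rfl

end Law

/-! ### Stationarity under an invariant initial law -/

section Stationary

variable {κ : ℝ≥0}

/-- **The section law of the restarted path**: for `θ ∈ (0, 2π)` and a measurable set of paths
`A`, `W{Y^θ_{h+·} ∈ A} = ∫ W{flowPath(y, ·) ∈ A} P_h(θ, dy)` (pathwise restart, independence of the
increments after `h` from `𝓕ᵂ_h`, and their Brownian law). [cite: Legall2016, Thm 2.20] -/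
theorem measure_shiftPath_flowPath_mem (hκ : κ ≤ 4) {θ : ℝ} (hθ : θ ∈ Ioo 0 (2 * Real.pi))
    (h : ℝ≥0) {A : Set C(ℝ≥0, ℝ)} (hA : MeasurableSet A) :
    preWienerMeasure {ω | shiftPath h (flowPath κ (θ, ω)) ∈ A} =
      ∫⁻ y, preWienerMeasure {ω' | flowPath κ (y, ω') ∈ A} ∂(sleKernel κ h θ) := by
  haveI := isProbabilityMeasure_preWienerMeasure'
  set Z : (ℝ≥0 → ℝ) → ℝ≥0 → ℝ := fun ω u ↦ brownianIncrAfter (fun _ ↦ (h : WithTop ℝ≥0)) u ω with hZ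
  set X : (ℝ≥0 → ℝ) → ℝ := sleArg κ θ h with hX
  have hτ : IsStoppingTime brownianFiltration (fun _ : ℝ≥0 → ℝ ↦ ((h : ℝ≥0) : WithTop ℝ≥0)) :=
    isStoppingTime_const _ _
  have hfin : ∀ᵐ ω ∂preWienerMeasure, (fun _ : ℝ≥0 → ℝ ↦ ((h : ℝ≥0) : WithTop ℝ≥0)) ω ≠ ⊤ :=
    ae_of_all _ fun _ ↦ WithTop.coe_ne_top
  have hXτ : Measurable[hτ.measurableSpace] X := by
    rw [IsStoppingTime.measurableSpace_const]
    exact measurable_sleArg_filtration κ θ h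
  have hXm : Measurable X := measurable_sleArg κ θ h
  have hZm : Measurable Z := measurable_brownianIncrAfter_pi hτ.measurable'
  -- a.e. the shifted path is the universal flow path of `(X, Z)`
  have hae : ∀ᵐ ω ∂preWienerMeasure,
      shiftPath h (flowPath κ (θ, ω)) = rawFlowPath κ (X ω, Z ω) := by
    filter_upwards [ae_sleLifetime_eq_top hκ hθ] with ω hω
    exact shiftPath_flowPath_eq hθ hω h
  have hS : MeasurableSet ((rawFlowPath κ) ⁻¹' A) := (measurable_rawFlowPath κ) hA
  have e1 : preWienerMeasure {ω | shiftPath h (flowPath κ (θ, ω)) ∈ A} =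
      preWienerMeasure {ω | rawFlowPath κ (X ω, Z ω) ∈ A} := by
    refine measure_congr ?_
    filter_upwards [hae] with ω hω
    show (ω ∈ {ω | shiftPath h (flowPath κ (θ, ω)) ∈ A}) = (ω ∈ {ω | rawFlowPath κ (X ω, Z ω) ∈ A})
    simp only [mem_setOf_eq, hω]
  -- the pair `(X, Z)` has the product law `P_h(θ, ·) ⊗ law(B)`
  have hind : IndepFun X Z preWienerMeasure := (indepFun_brownianIncrAfter hτ hfin hXτ).symm
  have hpair : preWienerMeasure.map (fun ω ↦ (X ω, Z ω)) =
      (preWienerMeasure.map X).prod (preWienerMeasure.map Z) :=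
    (indepFun_iff_map_prod_eq_prod_map_map hXm.aemeasurable hZm.aemeasurable).1 hind
  have hZlaw : preWienerMeasure.map Z = preWienerMeasure.map (fun ω u ↦ brownian u ω) :=
    (identDistrib_brownianIncrAfter hτ hfin).map_eq
  haveI : SFinite (preWienerMeasure.map Z) := by rw [hZlaw]; infer_instance
  have e2 : preWienerMeasure {ω | rawFlowPath κ (X ω, Z ω) ∈ A} =
      (preWienerMeasure.map (fun ω ↦ (X ω, Z ω))) ((rawFlowPath κ) ⁻¹' A) := by
    rw [Measure.map_apply (hXm.prodMk hZm) hS]; rfl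
  rw [e1, e2, hpair, Measure.prod_apply hS, ← sleKernel_apply]
  refine lintegral_congr fun y ↦ ?_
  rw [hZlaw, Measure.map_apply measurable_brownian_pi (measurable_prodMk_left hS)]
  refine congrArg _ ?_
  ext ω'
  simp only [mem_preimage, mem_setOf_eq]
  rw [rawFlowPath_brownian]

/-- **Stationarity of the flow law under an invariant initial law** (`κ ≤ 4`): if `μ` is a
probability measure on `(0, 2π)` with `μ P_h = μ`, then `flowLaw κ μ` is invariant under the time
shift by `h`. This is the one-sided stationary solution of the SLE_κ(0) angle equation
(Miller–Sheffield (2013), Prop. 2.1). [cite: MillerSheffield2013, Prop. 2.1] -/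
theorem map_shiftPath_flowLaw (hκ : κ ≤ 4) {μ : Measure ℝ} [IsProbabilityMeasure μ]
    (hμ : ∀ᵐ θ ∂μ, θ ∈ Ioo 0 (2 * Real.pi)) {h : ℝ≥0} (hinv : μ.bind (sleKernel κ h) = μ) :
    (flowLaw κ μ).map (shiftPath h) = flowLaw κ μ := by
  haveI := isProbabilityMeasure_preWienerMeasure'
  ext A hA
  have hSA : MeasurableSet (shiftPath h ⁻¹' A) := measurable_shiftPath h hA
  rw [Measure.map_apply (measurable_shiftPath h) hA, flowLaw_apply hSA, flowLaw_apply hA]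
  -- the measurable kernel `y ↦ W{flowPath(y, ·) ∈ A}`
  have hφ : Measurable fun y : ℝ ↦ preWienerMeasure {ω' | flowPath κ (y, ω') ∈ A} :=
    measurable_measure_prodMk_left ((measurable_flowPath κ) hA)
  calc ∫⁻ θ, preWienerMeasure {ω | flowPath κ (θ, ω) ∈ shiftPath h ⁻¹' A} ∂μ
      = ∫⁻ θ, ∫⁻ y, preWienerMeasure {ω' | flowPath κ (y, ω') ∈ A} ∂(sleKernel κ h θ) ∂μ := by
        refine lintegral_congr_ae ?_
        filter_upwards [hμ] with θ hθ
        exact measure_shiftPath_flowPath_mem hκ hθ h hA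
    _ = ∫⁻ y, preWienerMeasure {ω' | flowPath κ (y, ω') ∈ A} ∂(μ.bind (sleKernel κ h)) := by
        rw [Measure.lintegral_bind (sleKernel κ h).aemeasurable hφ.aemeasurable]
    _ = ∫⁻ θ, preWienerMeasure {ω | flowPath κ (θ, ω) ∈ A} ∂μ := by rw [hinv]

/-- **Stationarity under all shifts** when `μ` is invariant under all `P_t`. [folklore] -/
theorem map_shiftPath_flowLaw_of_forall (hκ : κ ≤ 4) {μ : Measure ℝ} [IsProbabilityMeasure μ]
    (hμ : ∀ᵐ θ ∂μ, θ ∈ Ioo 0 (2 * Real.pi)) (hinv : ∀ t, μ.bind (sleKernel κ t) = μ) (h : ℝ≥0) :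
    (flowLaw κ μ).map (shiftPath h) = flowLaw κ μ :=
  map_shiftPath_flowLaw hκ hμ (hinv h)

end Stationary

/-! ### The martingale problem under the flow law -/

section MartingaleProblem

variable {κ : ℝ≥0}

/-- The martingale-problem increment functional on one-sided paths is continuous. [folklore] -/
theorem continuous_oneSidedIncrement {f : ℝ → ℝ} (hf : ContDiff ℝ 2 f)
    (hsupp : tsupport f ⊆ Ioo 0 (2 * Real.pi)) (s t : ℝ≥0) :
    Continuous fun z : C(ℝ≥0, ℝ) ↦ f (z t) - f (z s) -
      ∫ r in (s : ℝ)..t, angleGenerator κ 0 f (z r.toNNReal) := by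
  have hev : Continuous fun q : C(ℝ≥0, ℝ) × ℝ ↦ q.1 q.2.toNNReal :=
    continuous_eval.comp (continuous_fst.prodMk (continuous_real_toNNReal.comp continuous_snd))
  have hL : Continuous (angleGenerator κ 0 f) := continuous_angleGenerator hf hsupp
  have hunc : Continuous (Function.uncurry fun (z : C(ℝ≥0, ℝ)) (r : ℝ) ↦
      angleGenerator κ 0 f (z r.toNNReal)) := by exact hL.comp hev
  refine ((hf.continuous.comp (continuous_eval_const t)).sub
    (hf.continuous.comp (continuous_eval_const s))).sub ?_
  exact intervalIntegral.continuous_parametric_intervalIntegral_of_continuous' hunc _ _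

/-- Bound on the increment functional. [folklore] -/
theorem abs_oneSidedIncrement_le {f : ℝ → ℝ} {Cf CL : ℝ} (hCf : ∀ y, |f y| ≤ Cf)
    (hCL : ∀ y, |angleGenerator κ 0 f y| ≤ CL) {s t : ℝ≥0} (hst : s ≤ t) (z : C(ℝ≥0, ℝ)) :
    |f (z t) - f (z s) - ∫ r in (s : ℝ)..t, angleGenerator κ 0 f (z r.toNNReal)| ≤
      2 * Cf + CL * ((t : ℝ) - s) := by
  have h1 : |∫ r in (s : ℝ)..t, angleGenerator κ 0 f (z r.toNNReal)| ≤ CL * |(t : ℝ) - s| := by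
    rw [← Real.norm_eq_abs]
    exact intervalIntegral.norm_integral_le_of_norm_le_const fun r _ ↦ by
      rw [Real.norm_eq_abs]; exact hCL _
  rw [abs_of_nonneg (sub_nonneg.2 (NNReal.coe_le_coe.2 hst))] at h1
  calc |f (z t) - f (z s) - ∫ r in (s : ℝ)..t, angleGenerator κ 0 f (z r.toNNReal)|
      ≤ |f (z t) - f (z s)| + |∫ r in (s : ℝ)..t, angleGenerator κ 0 f (z r.toNNReal)| :=
        abs_sub _ _
    _ ≤ |f (z t)| + |f (z s)| + |∫ r in (s : ℝ)..t, angleGenerator κ 0 f (z r.toNNReal)| := by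
        gcongr; exact abs_sub _ _
    _ ≤ Cf + Cf + CL * ((t : ℝ) - s) := add_le_add (add_le_add (hCf _) (hCf _)) h1
    _ = 2 * Cf + CL * ((t : ℝ) - s) := by ring

/-- **The flow law solves the SLE_κ(0) angle martingale problem, integrated against past
functionals** (`κ ≤ 4`, `μ` carried by `(0, 2π)`): for `f ∈ C²` compactly supported in `(0, 2π)`,
`s ≤ t`, and a bounded measurable `G` on paths which, along the flow path from every `θ ∈ (0, 2π)`,
agrees on `{T = ∞}` with a bounded `𝓕ᵂ_s`-measurable functional of the Brownian path,
`E_{flowLaw}[G · (f(Z_t) - f(Z_s) - ∫ₛᵗ L₀ f(Z_r) dr)] = 0`. (Generator identity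
`integral_mul_angleIncrement_sleArg_eq_zero`, Fubini.) [cite: KaratzasShreve1988, Ch. 5 §4.B] -/
theorem integral_mul_angleIncrement_flowLaw_eq_zero (hκ : κ ≤ 4) {μ : Measure ℝ}
    [IsProbabilityMeasure μ] (hμ : ∀ᵐ θ ∂μ, θ ∈ Ioo 0 (2 * Real.pi)) {f : ℝ → ℝ}
    (hf : ContDiff ℝ 2 f) (hfc : HasCompactSupport f) (hsupp : tsupport f ⊆ Ioo 0 (2 * Real.pi))
    {s t : ℝ≥0} (hst : s ≤ t) {G : C(ℝ≥0, ℝ) → ℝ} (hGm : Measurable G) {CG : ℝ}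
    (hGb : ∀ z, |G z| ≤ CG)
    (hGF : ∀ θ ∈ Ioo 0 (2 * Real.pi), ∃ G' : (ℝ≥0 → ℝ) → ℝ,
      Measurable[brownianFiltration s] G' ∧ (∀ ω, |G' ω| ≤ CG) ∧
        ∀ ω, sleLifetime κ θ ω = ⊤ → G (flowPath κ (θ, ω)) = G' ω) :
    ∫ z, G z * (f (z t) - f (z s) - ∫ r in (s : ℝ)..t, angleGenerator κ 0 f (z r.toNNReal))
      ∂(flowLaw κ μ) = 0 := by
  haveI := isProbabilityMeasure_preWienerMeasure'
  obtain ⟨Cf, -, hCf⟩ := exists_bound_of_hasCompactSupport hf.continuous hfc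
  obtain ⟨CL, hCL0, hCL⟩ := exists_bound_angleGenerator (κ := κ) (ρ := 0) hf hfc hsupp
  have hCf' : ∀ y, |f y| ≤ Cf := fun y ↦ by rw [← Real.norm_eq_abs]; exact hCf y
  set N : C(ℝ≥0, ℝ) → ℝ := fun z ↦ f (z t) - f (z s) -
    ∫ r in (s : ℝ)..t, angleGenerator κ 0 f (z r.toNNReal) with hN
  have hNm : Measurable N := (continuous_oneSidedIncrement hf hsupp s t).measurable
  have hNb : ∀ z, |N z| ≤ 2 * Cf + CL * ((t : ℝ) - s) := fun z ↦
    abs_oneSidedIncrement_le hCf' hCL hst z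
  have hGNb : ∀ z, |G z * N z| ≤ CG * (2 * Cf + CL * ((t : ℝ) - s)) := fun z ↦ by
    rw [abs_mul]
    exact mul_le_mul (hGb z) (hNb z) (abs_nonneg _) ((abs_nonneg _).trans (hGb z))
  have hGNm : Measurable fun z ↦ G z * N z := hGm.mul hNm
  change ∫ z, G z * N z ∂(flowLaw κ μ) = 0
  rw [integral_flowLaw hGNm hGNb]
  refine integral_eq_zero_of_ae ?_
  filter_upwards [hμ] with θ hθ
  obtain ⟨G', hG'm, hG'b, hG'eq⟩ := hGF θ hθ
  -- a.e. identification with the Brownian functionals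
  have hae : ∀ᵐ ω ∂preWienerMeasure, G (flowPath κ (θ, ω)) * N (flowPath κ (θ, ω)) =
      G' ω * (f (sleArg κ θ t ω) - f (sleArg κ θ s ω) -
        ∫ r in (s : ℝ)..t, angleGenerator κ 0 f (sleArg κ θ r.toNNReal ω)) := by
    filter_upwards [ae_sleLifetime_eq_top hκ hθ] with ω hω
    rw [hG'eq ω hω]
    simp only [hN, flowPath_apply_of_mem hθ hω]
  show ∫ ω, G (flowPath κ (θ, ω)) * N (flowPath κ (θ, ω)) ∂preWienerMeasure = 0
  rw [integral_congr_ae hae]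
  exact integral_mul_angleIncrement_sleArg_eq_zero hκ hθ hf hfc hsupp hst hG'm hG'b

/-- **The martingale problem integrated against past cylinder functionals**: for finitely many
times `v i ≤ s` and measurable sets `B i`,
`E_{flowLaw}[∏ᵢ 𝟙_{Bᵢ}(Z_{vᵢ}) · (f(Z_t) - f(Z_s) - ∫ₛᵗ L₀ f(Z_r) dr)] = 0`.
[cite: KaratzasShreve1988, Ch. 5 §4.B] -/
theorem integral_prod_indicator_mul_angleIncrement_flowLaw_eq_zero (hκ : κ ≤ 4) {μ : Measure ℝ}
    [IsProbabilityMeasure μ] (hμ : ∀ᵐ θ ∂μ, θ ∈ Ioo 0 (2 * Real.pi)) {f : ℝ → ℝ}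
    (hf : ContDiff ℝ 2 f) (hfc : HasCompactSupport f) (hsupp : tsupport f ⊆ Ioo 0 (2 * Real.pi))
    {s t : ℝ≥0} (hst : s ≤ t) {ι : Type*} (F : Finset ι) {v : ι → ℝ≥0} (hv : ∀ i ∈ F, v i ≤ s)
    {B : ι → Set ℝ} (hB : ∀ i ∈ F, MeasurableSet (B i)) :
    ∫ z, (∏ i ∈ F, (B i).indicator (1 : ℝ → ℝ) (z (v i))) *
      (f (z t) - f (z s) - ∫ r in (s : ℝ)..t, angleGenerator κ 0 f (z r.toNNReal))
      ∂(flowLaw κ μ) = 0 := by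
  classical
  have hind_b : ∀ (i : ι) (y : ℝ), |(B i).indicator (1 : ℝ → ℝ) y| ≤ 1 := fun i y ↦ by
    by_cases hy : y ∈ B i <;> simp [hy]
  have hprod_b : ∀ (w : ι → ℝ), |∏ i ∈ F, (B i).indicator (1 : ℝ → ℝ) (w i)| ≤ 1 := fun w ↦ by
    rw [Finset.abs_prod]
    exact Finset.prod_le_one (fun i _ ↦ abs_nonneg _) fun i _ ↦ hind_b i (w i)
  refine integral_mul_angleIncrement_flowLaw_eq_zero hκ hμ hf hfc hsupp hst
    (G := fun z ↦ ∏ i ∈ F, (B i).indicator (1 : ℝ → ℝ) (z (v i))) ?_ (CG := 1)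
    (fun z ↦ hprod_b fun i ↦ z (v i)) fun θ hθ ↦ ?_
  · exact Finset.measurable_prod _ fun i hi ↦
      ((measurable_const.indicator (hB i hi)).comp (measurable_eval_oneSided (v i)))
  · refine ⟨fun ω ↦ ∏ i ∈ F, (B i).indicator (1 : ℝ → ℝ) (sleArg κ θ (v i) ω), ?_,
      fun ω ↦ hprod_b fun i ↦ sleArg κ θ (v i) ω, fun ω hω ↦ ?_⟩
    · refine Finset.measurable_prod _ fun i hi ↦ ?_
      exact (measurable_const.indicator (hB i hi)).comp
        ((measurable_sleArg_filtration κ θ (v i)).mono (brownianFiltration.mono (hv i hi)) le_rfl)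
    · simp only [flowPath_apply_of_mem hθ hω]

end MartingaleProblem

end RadialLoewner

end Literature.Probability.RandomPlanarGeometry
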